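import Mathlib
import Summits.NavierStokesRegularity.NavierStokesRegularity.Theorems.FilamentSkeletonRssAreaLawSlavingHoloSlipZeros

/-!
# Area-law slaving, complex part 5b — unique zero of the continued slip in the disc of radius `|w′(c)|/sup|w″|`
# (`FilamentSkeletonRss`, child crux `TangentSkeletonNearStraight`, stmt-NavierStokesRegularity-28295, line
# `child_tangent_analytic_strip`, ∃-side of the registered stub `stub_analyticClosing`: the `StadiumAnalyticArea` conjunct)

Assembly of `Theorems.AreaLawSlavingHolo.ne_zero_of_deriv_sub_le` (part 5) with a SECOND-DERIVATIVE bound, the form in which the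
crux supplies the input (`w″ = O(Γ^{-1/2})` along near-straight filaments, `w′(c) ≥ 3/2 + δ`): on an open convex `U` with
`‖w″‖ ≤ K₂`, the slip has no zero other than `c` in `U ∩ B(c, R)` as soon as `K₂·R < |w′(c)|` — a disc of radius `∼ √Γ`, much wider
than the stadium `cs√Γ` for `cs` small; beyond it the real slip floor takes over (`ne_zero_of_real_floor`).

* `deriv_sub_le_of_second_deriv_le` — `‖w′(ζ) − w′(c)‖ ≤ K₂‖ζ − c‖` on `U`;
* `ne_zero_near_of_second_deriv_le` — `w z ≠ 0` for `z ∈ U`, `z ≠ c`, `‖z − c‖ < R`, `K₂ R < ‖w′(c)‖`.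

HONEST FRAMING: elementary complex analysis serving a HYPOTHETICAL filament skeleton on the NEGATIVE side of a MODEL route; no registered
stub is closed by this file and nothing here bears on Navier–Stokes regularity or blow-up.  `--supports stmt-NavierStokesRegularity-28295`.
-/

set_option linter.dupNamespace false

noncomputable section

namespace Summit.NavierStokesRegularity.NavierStokesRegularity.Theorems.AreaLawSlavingHolo

open Set MeasureTheory Metric Filter
open scoped Topology

/-- **First-derivative increments from a second-derivative bound** on an open convex set. [folklore] -/
theorem deriv_sub_le_of_second_deriv_le {U : Set ℂ} (hUo : IsOpen U) (hUc : Convex ℝ U) {w : ℂ → ℂ}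
    (hw : DifferentiableOn ℂ w U) {K₂ : ℝ} (hK₂ : ∀ ζ ∈ U, ‖deriv (deriv w) ζ‖ ≤ K₂) {ζ c : ℂ} (hζ : ζ ∈ U) (hc : c ∈ U) :
    ‖deriv w ζ - deriv w c‖ ≤ K₂ * ‖ζ - c‖ :=
  norm_sub_le_of_deriv_le hUo hUc (hw.analyticOnNhd hUo).deriv.differentiableOn hK₂ hζ hc

/-- **Unique zero in the non-degeneracy disc.**  `U` open convex, `w` holomorphic on `U` with `‖w″‖ ≤ K₂` on `U`, `w c = 0` at
`c ∈ U`.  If `z ∈ U`, `z ≠ c`, `‖z − c‖ < R` and `K₂·R < ‖w′(c)‖`, then `w z ≠ 0`. [folklore] -/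
theorem ne_zero_near_of_second_deriv_le {U : Set ℂ} (hUo : IsOpen U) (hUc : Convex ℝ U) {w : ℂ → ℂ}
    (hw : DifferentiableOn ℂ w U) {K₂ : ℝ} (hK₂ : ∀ ζ ∈ U, ‖deriv (deriv w) ζ‖ ≤ K₂) {c : ℂ} (hc : c ∈ U) (hwc : w c = 0)
    {R : ℝ} (hR : K₂ * R < ‖deriv w c‖) {z : ℂ} (hz : z ∈ U) (hzc : z ≠ c) (hzR : ‖z - c‖ < R) : w z ≠ 0 := by
  have hK₂0 : 0 ≤ K₂ := le_trans (norm_nonneg _) (hK₂ c hc)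
  have hR0 : 0 < R := lt_of_le_of_lt (norm_nonneg _) hzR
  -- the convex open piece `K = U ∩ B(c, R)`
  set K : Set ℂ := U ∩ ball c R with hK
  have hKo : IsOpen K := hUo.inter isOpen_ball
  have hKc : Convex ℝ K := hUc.inter (convex_ball c R)
  have hKU : K ⊆ U := inter_subset_left
  have hcK : c ∈ K := ⟨hc, mem_ball_self hR0⟩
  have hzK : z ∈ K := ⟨hz, by rw [mem_ball, dist_eq_norm]; exact hzR⟩
  have hwK : DifferentiableOn ℂ w K := hw.mono hKU
  -- on `K` the derivative is within `K₂ R` of `w′(c)`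
  have hdev : ∀ ζ ∈ K, ‖deriv w ζ - deriv w c‖ ≤ K₂ * R := by
    intro ζ hζ
    refine (deriv_sub_le_of_second_deriv_le hUo hUc hw hK₂ (hKU hζ) hc).trans ?_
    have : ‖ζ - c‖ < R := by have h := hζ.2; rwa [mem_ball, dist_eq_norm] at h
    exact mul_le_mul_of_nonneg_left this.le hK₂0
  exact ne_zero_of_deriv_sub_le hKo hKc hwK hdev hR hcK hwc hzK hzc

end Summit.NavierStokesRegularity.NavierStokesRegularity.Theorems.AreaLawSlavingHolo
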